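import Summits.CriticalPhenomena.SAWScalingLimit.Theorems.SAWDevelopingMapNoFoldBoundThreeClass

/-!
# `NoFoldBound`, line Ideator3Sketch — the three-class inequality, middle-port DOMINANCE form

Crux `NoFoldBound` (stmt-CriticalPhenomena-8296), route `SAWDevelopingMap`, lead seat c3 (depth-2 stratum of
`stub_collarCoherence`). `three_class_bound` (file `…ThreeClass`) decides the three-class configuration under a
LINEAR balance hypothesis in the total outer mass `s₁ + s₂`; exact enumeration (this seat, discs and bricks up
to 61 vertices, all sources, all depth-2 vertices) shows that form is violated in the harmless regime where ONE
outer port dominates (`N_mid/(N_lo + N_hi)` down to `0.085` while the quotient stays `≤ 0.62`), whereas the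
middle port always carries at least `3.6×` the SMALLER outer port. This file proves the form of the inequality
that matches the data: with dressing box `(3/5) s_j ≤ b_j ≤ (4/5) s_j` (i.e. slit loops `≤ c₀` with
`r(c₀) ≤ 4/5`, and `β_T/α_T ≥ 3/5`) and the DOMINANCE hypothesis `min(s₁, s₂) ≤ s₀` (the middle class carries at
least the smaller neighbouring class),

  `‖b₀ + b₁ e^{13πi/12} + b₂ e^{−13πi/12}‖ ≤ (19/20) ‖s₀ + s₁ e^{5πi/12} + s₂ e^{−5πi/12}‖`

(`three_class_bound_min`, from the real core `three_class_min_core`; numerics of `cos²(π/12) = 1/2 + √3/4`).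
Pure real/complex algebra; nothing about walks is used or asserted. [folklore]
-/

noncomputable section

namespace Summit.CriticalPhenomena.SAWScalingLimit.Theorems.SAWDevelopingMapNoFoldBound

open Complex

/-! ### Numerics of `cos(π/12)`, `sin(π/12)` -/

/-- `cos²(π/12) = 1/2 + √3/4`. -/
theorem cos_sq_pi_div_twelve : Real.cos (Real.pi / 12) ^ 2 = 1 / 2 + Real.sqrt 3 / 4 := by
  rw [Real.cos_sq, show 2 * (Real.pi / 12) = Real.pi / 6 by ring, Real.cos_pi_div_six]
  ring

/-- `sin²(π/12) = 1/2 − √3/4`. -/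
theorem sin_sq_pi_div_twelve : Real.sin (Real.pi / 12) ^ 2 = 1 / 2 - Real.sqrt 3 / 4 := by
  have h := Real.sin_sq_add_cos_sq (Real.pi / 12)
  rw [cos_sq_pi_div_twelve] at h
  linarith

/-- `1.732 ≤ √3 ≤ 1.73206`. -/
theorem sqrt_three_bounds : (1.732 : ℝ) ≤ Real.sqrt 3 ∧ Real.sqrt 3 ≤ 1.73206 := by
  constructor
  · exact Real.le_sqrt_of_sq_le (by norm_num)
  · exact le_of_lt ((Real.sqrt_lt' (by norm_num)).2 (by norm_num))

/-- Numerical enclosures: `(933 / 1000 : ℝ) ≤ cos²(π/12) ≤ (93302 / 100000 : ℝ)`, `(6698 / 100000 : ℝ) ≤ sin²(π/12) ≤ (67 / 1000 : ℝ)`,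
`(9659 / 10000 : ℝ) ≤ cos(π/12)`, `(2588 / 10000 : ℝ) ≤ sin(π/12)`. -/
theorem trig_pi_div_twelve_bounds :
    (933 / 1000 : ℝ) ≤ Real.cos (Real.pi / 12) ^ 2 ∧ Real.cos (Real.pi / 12) ^ 2 ≤ (93302 / 100000 : ℝ) ∧
    (6698 / 100000 : ℝ) ≤ Real.sin (Real.pi / 12) ^ 2 ∧ Real.sin (Real.pi / 12) ^ 2 ≤ (67 / 1000 : ℝ) ∧
    (9659 / 10000 : ℝ) ≤ Real.cos (Real.pi / 12) ∧ (2588 / 10000 : ℝ) ≤ Real.sin (Real.pi / 12) := by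
  obtain ⟨h1, h2⟩ := sqrt_three_bounds
  have hC2 := cos_sq_pi_div_twelve
  have hS2 := sin_sq_pi_div_twelve
  have hC0 : 0 ≤ Real.cos (Real.pi / 12) :=
    Real.cos_nonneg_of_mem_Icc ⟨by linarith [Real.pi_pos], by linarith [Real.pi_pos]⟩
  have hS0 : 0 ≤ Real.sin (Real.pi / 12) :=
    Real.sin_nonneg_of_nonneg_of_le_pi (by positivity) (by linarith [Real.pi_pos])
  refine ⟨by linarith, by linarith, by linarith, by linarith, ?_, ?_⟩
  · nlinarith
  · nlinarith

/-! ### The real core -/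

/-- The real-arithmetic core of `three_class_bound_min` (`C = cos(π/12)`, `σ = sin(π/12)` abstracted with their
enclosures): dressing box `[3/5, 4/5]`, `s₂ ≤ s₁`, dominance `s₂ ≤ s₀`. -/
theorem three_class_min_core {s₀ s₁ s₂ b₀ b₁ b₂ C σ : ℝ}
    (hs₀ : 0 ≤ s₀) (hs₁ : 0 ≤ s₁) (hs₂ : 0 ≤ s₂) (h21 : s₂ ≤ s₁) (h20 : s₂ ≤ s₀)
    (hb₀l : 3 / 5 * s₀ ≤ b₀) (hb₀u : b₀ ≤ 4 / 5 * s₀)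
    (hb₁l : 3 / 5 * s₁ ≤ b₁) (hb₁u : b₁ ≤ 4 / 5 * s₁) (hb₂l : 3 / 5 * s₂ ≤ b₂) (hb₂u : b₂ ≤ 4 / 5 * s₂)
    (hC0 : 0 ≤ C) (_hσ0 : 0 ≤ σ) (hC2l : (933 / 1000 : ℝ) ≤ C ^ 2) (hC2u : C ^ 2 ≤ (93302 / 100000 : ℝ))
    (hσ2l : (6698 / 100000 : ℝ) ≤ σ ^ 2) (hσ2u : σ ^ 2 ≤ (67 / 1000 : ℝ)) (hCl : (9659 / 10000 : ℝ) ≤ C) (hσl : (2588 / 10000 : ℝ) ≤ σ) :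
    (b₀ - (b₁ + b₂) * C) ^ 2 + ((b₁ - b₂) * σ) ^ 2 ≤
      (19 / 20) ^ 2 * ((s₀ + (s₁ + s₂) * σ) ^ 2 + ((s₁ - s₂) * C) ^ 2) := by
  -- the imaginary part of the Beltrami side
  have hdiff : (b₁ - b₂) ^ 2 ≤ (4 / 5 * s₁ - 3 / 5 * s₂) ^ 2 := by
    have hup : b₁ - b₂ ≤ 4 / 5 * s₁ - 3 / 5 * s₂ := by linarith
    have hlo : -(4 / 5 * s₁ - 3 / 5 * s₂) ≤ b₁ - b₂ := by linarith
    have h0 : 0 ≤ 4 / 5 * s₁ - 3 / 5 * s₂ := by linarith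
    exact sq_le_sq' hlo hup
  have him : ((b₁ - b₂) * σ) ^ 2 ≤ (67 / 1000 : ℝ) * (4 / 5 * s₁ - 3 / 5 * s₂) ^ 2 := by
    calc ((b₁ - b₂) * σ) ^ 2 = (b₁ - b₂) ^ 2 * σ ^ 2 := by ring
      _ ≤ (4 / 5 * s₁ - 3 / 5 * s₂) ^ 2 * (67 / 1000 : ℝ) :=
          mul_le_mul hdiff hσ2u (sq_nonneg _) (sq_nonneg _)
      _ = _ := by ring
  have hSg0 : 0 ≤ (s₁ + s₂) * σ := by positivity
  have hS0 : 0 ≤ s₀ + (s₁ + s₂) * σ := by positivity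
  -- the sum side, lower bounds
  have hSsq_l : (s₀ + (s₁ + s₂) * σ) ^ 2 ≥ s₀ ^ 2 := by nlinarith
  rcases le_or_gt ((b₁ + b₂) * C) b₀ with h | h
  · /- case (i): `b₀ ≥ C(b₁ + b₂)` — the middle class dominates the Beltrami side -/
    have hb12 : 0 ≤ (b₁ + b₂) * C := by
      have : 0 ≤ b₁ + b₂ := by linarith
      positivity
    have hre : (b₀ - (b₁ + b₂) * C) ^ 2 ≤ (4 / 5 * s₀) ^ 2 := by
      have h1 : 0 ≤ b₀ - (b₁ + b₂) * C := by linarith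
      have h2 : b₀ - (b₁ + b₂) * C ≤ 4 / 5 * s₀ := by linarith
      exact pow_le_pow_left₀ h1 h2 2
    have hC2D : (933 / 1000 : ℝ) * (s₁ - s₂) ^ 2 ≤ ((s₁ - s₂) * C) ^ 2 := by
      calc (933 / 1000 : ℝ) * (s₁ - s₂) ^ 2 ≤ C ^ 2 * (s₁ - s₂) ^ 2 :=
            mul_le_mul_of_nonneg_right hC2l (sq_nonneg _)
        _ = ((s₁ - s₂) * C) ^ 2 := by ring
    nlinarith [sq_nonneg (s₁ - s₂), sq_nonneg s₂, hre, him, hC2D, hSsq_l, h20, hs₂]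
  · /- case (ii): `b₀ < C(b₁ + b₂)` — the fold regime; reduce to `s₀ = s₂` and a positive definite form -/
    set R := (b₁ + b₂) * C - b₀ with hR
    have hR0 : 0 ≤ R := by rw [hR]; linarith
    -- `R ≤ R'(s₀) := (4/5) C (s₁ + s₂) − (3/5) s₀ ≤ R'(s₂)`
    have hRle : R ≤ 4 / 5 * C * (s₁ + s₂) - 3 / 5 * s₂ := by
      have : (b₁ + b₂) * C ≤ (4 / 5 * s₁ + 4 / 5 * s₂) * C :=
        mul_le_mul_of_nonneg_right (by linarith) hC0
      rw [hR]; nlinarith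
    have hR'0 : 0 ≤ 4 / 5 * C * (s₁ + s₂) - 3 / 5 * s₂ := hR0.trans hRle
    have hre : (b₀ - (b₁ + b₂) * C) ^ 2 ≤ (4 / 5 * C * (s₁ + s₂) - 3 / 5 * s₂) ^ 2 := by
      rw [show b₀ - (b₁ + b₂) * C = -R by rw [hR]; ring, neg_sq]
      exact pow_le_pow_left₀ hR0 hRle 2
    -- the sum side at `s₀ ↦ s₂`
    have hSre : (s₂ + (s₁ + s₂) * σ) ^ 2 ≤ (s₀ + (s₁ + s₂) * σ) ^ 2 :=
      pow_le_pow_left₀ (by positivity) (by linarith) 2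
    -- rational enclosures of the `s₀`-free inequality
    have hQS : 0 ≤ s₂ * (s₁ + s₂) := by positivity
    have e1 : (4 / 5 * C * (s₁ + s₂) - 3 / 5 * s₂) ^ 2 =
        16 / 25 * C ^ 2 * (s₁ + s₂) ^ 2 - 24 / 25 * C * (s₂ * (s₁ + s₂)) + 9 / 25 * s₂ ^ 2 := by ring
    have e2 : (s₂ + (s₁ + s₂) * σ) ^ 2 = s₂ ^ 2 + 2 * σ * (s₂ * (s₁ + s₂)) + σ ^ 2 * (s₁ + s₂) ^ 2 := by
      ring
    have u1 : 16 / 25 * C ^ 2 * (s₁ + s₂) ^ 2 ≤ 16 / 25 * (93302 / 100000 : ℝ) * (s₁ + s₂) ^ 2 := by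
      have := mul_le_mul_of_nonneg_right hC2u (sq_nonneg (s₁ + s₂)); linarith
    have u2 : 24 / 25 * (9659 / 10000 : ℝ) * (s₂ * (s₁ + s₂)) ≤ 24 / 25 * C * (s₂ * (s₁ + s₂)) := by
      have := mul_le_mul_of_nonneg_right hCl hQS; linarith
    have l1 : 2 * (2588 / 10000 : ℝ) * (s₂ * (s₁ + s₂)) ≤ 2 * σ * (s₂ * (s₁ + s₂)) := by
      have := mul_le_mul_of_nonneg_right hσl hQS; linarith
    have l2 : (6698 / 100000 : ℝ) * (s₁ + s₂) ^ 2 ≤ σ ^ 2 * (s₁ + s₂) ^ 2 :=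
      mul_le_mul_of_nonneg_right hσ2l (sq_nonneg _)
    have l3 : (933 / 1000 : ℝ) * (s₁ - s₂) ^ 2 ≤ ((s₁ - s₂) * C) ^ 2 := by
      calc (933 / 1000 : ℝ) * (s₁ - s₂) ^ 2 ≤ C ^ 2 * (s₁ - s₂) ^ 2 :=
            mul_le_mul_of_nonneg_right hC2l (sq_nonneg _)
        _ = ((s₁ - s₂) * C) ^ 2 := by ring
    -- the positive definite binary form (discriminant < 0)
    have hF : 0 ≤ (361 / 400) * (s₂ ^ 2 + 2 * (2588 / 10000 : ℝ) * (s₂ * (s₁ + s₂)) + (6698 / 100000 : ℝ) * (s₁ + s₂) ^ 2 +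
          (933 / 1000 : ℝ) * (s₁ - s₂) ^ 2) -
        (16 / 25 * (93302 / 100000 : ℝ) * (s₁ + s₂) ^ 2 - 24 / 25 * (9659 / 10000 : ℝ) * (s₂ * (s₁ + s₂)) + 9 / 25 * s₂ ^ 2 +
          (67 / 1000 : ℝ) * (4 / 5 * s₁ - 3 / 5 * s₂) ^ 2) := by
      linarith [sq_nonneg ((44362543 / 10000000 : ℝ) * s₂ + (-12987137 / 10000000 : ℝ) * s₁), sq_nonneg s₁, sq_nonneg s₂]
    linarith [hre, him, hSre, e1, e2, u1, u2, l1, l2, l3, hF]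

/-! ### The inequality -/

/-- **The three-class inequality, dominance form (depth-2 stratum).** Real nonnegative dressed masses:
middle class `s₀, b₀`, neighbouring classes `s₁, b₁` and `s₂, b₂`, dressing box `(3/5) s_j ≤ b_j ≤ (4/5) s_j`,
`s₂ ≤ s₁`, and MIDDLE-PORT DOMINANCE `s₂ ≤ s₀` (the middle class carries at least the smaller neighbouring
class). Then `‖b₀ + b₁ e^{13πi/12} + b₂ e^{−13πi/12}‖ ≤ (19/20) ‖s₀ + s₁ e^{5πi/12} + s₂ e^{−5πi/12}‖`.
[folklore] -/
theorem three_class_bound_min {s₀ s₁ s₂ b₀ b₁ b₂ : ℝ}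
    (hs₀ : 0 ≤ s₀) (hs₁ : 0 ≤ s₁) (hs₂ : 0 ≤ s₂) (h21 : s₂ ≤ s₁) (h20 : s₂ ≤ s₀)
    (hb₀l : 3 / 5 * s₀ ≤ b₀) (hb₀u : b₀ ≤ 4 / 5 * s₀)
    (hb₁l : 3 / 5 * s₁ ≤ b₁) (hb₁u : b₁ ≤ 4 / 5 * s₁) (hb₂l : 3 / 5 * s₂ ≤ b₂) (hb₂u : b₂ ≤ 4 / 5 * s₂) :
    ‖(b₀ : ℂ) + b₁ * Complex.exp ((13 * Real.pi / 12 : ℝ) * Complex.I) +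
        b₂ * Complex.exp (-((13 * Real.pi / 12 : ℝ) * Complex.I))‖ ≤
      19 / 20 * ‖(s₀ : ℂ) + s₁ * Complex.exp ((5 * Real.pi / 12 : ℝ) * Complex.I) +
        s₂ * Complex.exp (-((5 * Real.pi / 12 : ℝ) * Complex.I))‖ := by
  obtain ⟨hC2l, hC2u, hσ2l, hσ2u, hCl, hσl⟩ := trig_pi_div_twelve_bounds
  have hC0 : 0 ≤ Real.cos (Real.pi / 12) := by linarith
  have hσ0 : 0 ≤ Real.sin (Real.pi / 12) := by linarith
  have eB : ‖(b₀ : ℂ) + b₁ * Complex.exp ((13 * Real.pi / 12 : ℝ) * Complex.I) +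
        b₂ * Complex.exp (-((13 * Real.pi / 12 : ℝ) * Complex.I))‖ ^ 2 =
      (b₀ - (b₁ + b₂) * Real.cos (Real.pi / 12)) ^ 2 + ((b₁ - b₂) * Real.sin (Real.pi / 12)) ^ 2 := by
    rw [three_class_normSq_eq, cos_thirteen_pi_div_twelve, sin_thirteen_pi_div_twelve]; ring
  have eS : ‖(s₀ : ℂ) + s₁ * Complex.exp ((5 * Real.pi / 12 : ℝ) * Complex.I) +
        s₂ * Complex.exp (-((5 * Real.pi / 12 : ℝ) * Complex.I))‖ ^ 2 =
      (s₀ + (s₁ + s₂) * Real.sin (Real.pi / 12)) ^ 2 + ((s₁ - s₂) * Real.cos (Real.pi / 12)) ^ 2 := by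
    rw [three_class_normSq_eq, cos_five_pi_div_twelve, sin_five_pi_div_twelve]
  rw [← abs_of_nonneg (norm_nonneg _),
    ← abs_of_nonneg (mul_nonneg (by norm_num : (0 : ℝ) ≤ 19 / 20) (norm_nonneg _)), ← sq_le_sq, mul_pow,
    eB, eS]
  exact three_class_min_core hs₀ hs₁ hs₂ h21 h20 hb₀l hb₀u hb₁l hb₁u hb₂l hb₂u hC0 hσ0 hC2l hC2u hσ2l
    hσ2u hCl hσl

/-- **Dominance form, symmetric statement.** As `three_class_bound_min`, with the outer classes in either order:
`min(s₁, s₂) ≤ s₀`. (The two norms are invariant under exchanging the indices `1, 2`, which conjugates both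
superpositions.) [folklore] -/
theorem three_class_bound_min' {s₀ s₁ s₂ b₀ b₁ b₂ : ℝ}
    (hs₀ : 0 ≤ s₀) (hs₁ : 0 ≤ s₁) (hs₂ : 0 ≤ s₂) (hmin : min s₁ s₂ ≤ s₀)
    (hb₀l : 3 / 5 * s₀ ≤ b₀) (hb₀u : b₀ ≤ 4 / 5 * s₀)
    (hb₁l : 3 / 5 * s₁ ≤ b₁) (hb₁u : b₁ ≤ 4 / 5 * s₁) (hb₂l : 3 / 5 * s₂ ≤ b₂) (hb₂u : b₂ ≤ 4 / 5 * s₂) :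
    ‖(b₀ : ℂ) + b₁ * Complex.exp ((13 * Real.pi / 12 : ℝ) * Complex.I) +
        b₂ * Complex.exp (-((13 * Real.pi / 12 : ℝ) * Complex.I))‖ ≤
      19 / 20 * ‖(s₀ : ℂ) + s₁ * Complex.exp ((5 * Real.pi / 12 : ℝ) * Complex.I) +
        s₂ * Complex.exp (-((5 * Real.pi / 12 : ℝ) * Complex.I))‖ := by
  rcases le_total s₂ s₁ with h | h
  · exact three_class_bound_min hs₀ hs₁ hs₂ h (by rw [min_eq_right h] at hmin; exact hmin)
      hb₀l hb₀u hb₁l hb₁u hb₂l hb₂u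
  · -- exchange the indices 1 and 2: both norms are norms of conjugates
    have key := three_class_bound_min hs₀ hs₂ hs₁ h (by rw [min_eq_left h] at hmin; exact hmin)
      hb₀l hb₀u hb₂l hb₂u hb₁l hb₁u
    have swapB : ‖(b₀ : ℂ) + b₁ * Complex.exp ((13 * Real.pi / 12 : ℝ) * Complex.I) +
          b₂ * Complex.exp (-((13 * Real.pi / 12 : ℝ) * Complex.I))‖ =
        ‖(b₀ : ℂ) + b₂ * Complex.exp ((13 * Real.pi / 12 : ℝ) * Complex.I) +
          b₁ * Complex.exp (-((13 * Real.pi / 12 : ℝ) * Complex.I))‖ := by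
      have h2 : ‖(b₀ : ℂ) + b₁ * Complex.exp ((13 * Real.pi / 12 : ℝ) * Complex.I) +
            b₂ * Complex.exp (-((13 * Real.pi / 12 : ℝ) * Complex.I))‖ ^ 2 =
          ‖(b₀ : ℂ) + b₂ * Complex.exp ((13 * Real.pi / 12 : ℝ) * Complex.I) +
            b₁ * Complex.exp (-((13 * Real.pi / 12 : ℝ) * Complex.I))‖ ^ 2 := by
        rw [three_class_normSq_eq, three_class_normSq_eq]; ring
      rw [← Real.sqrt_sq (norm_nonneg _), h2, Real.sqrt_sq (norm_nonneg _)]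
    have swapS : ‖(s₀ : ℂ) + s₁ * Complex.exp ((5 * Real.pi / 12 : ℝ) * Complex.I) +
          s₂ * Complex.exp (-((5 * Real.pi / 12 : ℝ) * Complex.I))‖ =
        ‖(s₀ : ℂ) + s₂ * Complex.exp ((5 * Real.pi / 12 : ℝ) * Complex.I) +
          s₁ * Complex.exp (-((5 * Real.pi / 12 : ℝ) * Complex.I))‖ := by
      have h2 : ‖(s₀ : ℂ) + s₁ * Complex.exp ((5 * Real.pi / 12 : ℝ) * Complex.I) +
            s₂ * Complex.exp (-((5 * Real.pi / 12 : ℝ) * Complex.I))‖ ^ 2 =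
          ‖(s₀ : ℂ) + s₂ * Complex.exp ((5 * Real.pi / 12 : ℝ) * Complex.I) +
            s₁ * Complex.exp (-((5 * Real.pi / 12 : ℝ) * Complex.I))‖ ^ 2 := by
        rw [three_class_normSq_eq, three_class_normSq_eq]; ring
      rw [← Real.sqrt_sq (norm_nonneg _), h2, Real.sqrt_sq (norm_nonneg _)]
    rw [swapB, swapS]
    exact key

end Summit.CriticalPhenomena.SAWScalingLimit.Theorems.SAWDevelopingMapNoFoldBound
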